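import Mathlib
import HarnessLib
import Literature.Algebra.Polynomial.DescartesSignVariations
import Summits.ValiantsHypothesis.ValiantsHypothesis.Theorems.LacunarySymmetroidMatrixDescartesProductPlusOneSharpKSector

/-!
# ValiantsHypothesis / LacunarySymmetroid — crux `MatrixDescartes` (stmt-ValiantsHypothesis-18050, V1),
# LINE (A) «product_plus_one»: the SHARP SECTOR, SIGN-AWARE COUNT `Z₊ ≤ (K−1)m + 2`

`sharpK_sector_pos_roots` (✓ part 4) bounds the positive zeros of `h = κ X^N + ∏_j f_j` (all `f_j` Descartes-sharp) by twice the
number of zero-free components.  Here the constant is halved to val-v1x-eng-10's **`(K−1)m + 2`** (line indexing; `Km + 2` for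
`(K+1)`-nomials): `sharpK_sector_pos_roots_signed`, `sharpK_sector_class_signed`.  Proof: at every zero `z` of `h`,
`P(z) = −κ z^N` has the FIXED sign `−sgn κ`; hence between two consecutive zeros of `h` the zeros of `P` have EVEN total multiplicity
(BPR parity, `Literature…Descartes.even_countP_roots_gt_iff`), i.e. `0` or `≥ 2`; and two consecutive multiplicity-`0` gaps would put
three zeros of `h` in one zero-free interval of `P`, impossible by the monotonicity of `Φ = Σ_j x f_j′/f_j` (✓ `sharp_phi_strictAnti`)
and Rolle for `θ_N`.  So every second gap carries multiplicity `≥ 2` of the `≤ Km` positive zeros of `P` (with multiplicity).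

HONEST FRAMING: a SECTOR constant; NOT `stub_classRowK3`, not `stub_eulerBoundK3`, not `stub_polyLaw`, not `ProductPlusOneMDR`, not
`MatrixDescartes`, not Conjecture B; `VP ≠ VNP` is NOT proved.  No definitions, no named facts.
-/

-- `Summit.ValiantsHypothesis.ValiantsHypothesis.…` is the tree's mandated single-conjunct layout (Sub = Summit).
set_option linter.dupNamespace false

namespace Summit.ValiantsHypothesis.ValiantsHypothesis.Theorems.LacunarySymmetroidMatrixDescartes

namespace ProductPlusOne

open Polynomial Finset
open scoped BigOperators

/-- **Parity**: if `P(a)·P(b) > 0` (`a < b`) and `P` has a zero in `(a, b)`, then `P` has at least TWO zeros in `(a, b)` counted with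
multiplicity. [folklore; cite: BasuPollackRoy2006 Prop. 2.21 for the parity] -/
theorem two_le_countP_Ioo_of_same_sign (P : ℝ[X]) {a b : ℝ} (hab : a < b) (hsign : 0 < P.eval a * P.eval b)
    (hroot : ∃ t ∈ Set.Ioo a b, P.eval t = 0) :
    2 ≤ P.roots.countP (fun t => a < t ∧ t < b) := by
  classical
  have ha : P.eval a ≠ 0 := fun h => by rw [h, zero_mul] at hsign; exact lt_irrefl 0 hsign
  have hb : P.eval b ≠ 0 := fun h => by rw [h, mul_zero] at hsign; exact lt_irrefl 0 hsign
  have hP : P ≠ 0 := fun h => ha (by rw [h, eval_zero])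
  -- split countP (a < ·) = countP (a < · < b) + countP (b < ·)
  have hsplit : P.roots.countP (fun t => a < t) = P.roots.countP (fun t => a < t ∧ t < b) + P.roots.countP (fun t => b < t) := by
    rw [Multiset.countP_eq_countP_filter_add P.roots (fun t => a < t) (fun t => t < b), Multiset.countP_filter,
      Multiset.countP_filter]
    congr 1
    refine Multiset.countP_congr rfl (fun t ht => ?_)
    have htb : t ≠ b := fun h => hb (by rw [← h]; exact (mem_roots hP).mp ht)
    simp only [not_lt, eq_iff_iff]
    constructor
    · rintro ⟨h1, h2⟩; exact lt_of_le_of_ne h2 (Ne.symm htb)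
    · intro h; exact ⟨hab.trans h, h.le⟩
  -- parities
  have hpa := Literature.Algebra.Polynomial.Descartes.even_countP_roots_gt_iff ha
  have hpb := Literature.Algebra.Polynomial.Descartes.even_countP_roots_gt_iff hb
  have hiff : Even (P.roots.countP (fun t => a < t)) ↔ Even (P.roots.countP (fun t => b < t)) := by
    rw [hpa, hpb]
    constructor
    · intro h; nlinarith [hsign, h, sq_nonneg (P.eval a), mul_pos h hsign]
    · intro h; nlinarith [hsign, h, sq_nonneg (P.eval b), mul_pos h hsign]
  have heven : Even (P.roots.countP (fun t => a < t ∧ t < b)) := by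
    have hx : Even (P.roots.countP (fun t => a < t)) ↔
        (Even (P.roots.countP (fun t => a < t ∧ t < b)) ↔ Even (P.roots.countP (fun t => b < t))) := by
      rw [hsplit]; exact Nat.even_add
    by_cases hB : Even (P.roots.countP (fun t => b < t))
    · exact (hx.mp (hiff.mpr hB)).mpr hB
    · by_contra hA
      exact hB (hiff.mp (hx.mpr ⟨fun h => absurd h hA, fun h => absurd h hB⟩))
  -- at least one
  have hpos : 0 < P.roots.countP (fun t => a < t ∧ t < b) := by
    rw [Multiset.countP_pos]
    obtain ⟨t, ht, h0⟩ := hroot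
    exact ⟨t, (mem_roots hP).mpr h0, ht.1, ht.2⟩
  obtain ⟨r, hr⟩ := heven
  omega

/-- Positive zeros of a product of sharp `(K+1)`-nomials, WITH multiplicity: at most `K·m`. [folklore] -/
theorem countP_pos_roots_prod_sparse_le {m : ℕ} (K : ℕ) (d : ℕ → ℕ) (hd : StrictMono d) (c : Fin m → ℕ → ℝ)
    (hc : ∀ j i, i < K + 1 → c j i ≠ 0) :
    (∏ j, (∑ i ∈ Finset.range (K + 1), C (c j i) * X ^ (d i) : ℝ[X])).roots.countP (fun t => 0 < t) ≤ K * m := by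
  classical
  have hne : ∀ j, (∑ i ∈ Finset.range (K + 1), C (c j i) * X ^ (d i) : ℝ[X]) ≠ 0 :=
    fun j => (sparse_leadingCoeff K d hd (c j) (hc j K (by omega))).2
  have key : ∀ s : Finset (Fin m),
      (∏ j ∈ s, (∑ i ∈ Finset.range (K + 1), C (c j i) * X ^ (d i) : ℝ[X])).roots.countP (fun t => 0 < t) ≤ K * s.card := by
    intro s
    induction s using Finset.induction_on with
    | empty => simp
    | @insert a s ha ih =>
      rw [Finset.prod_insert ha, roots_mul (mul_ne_zero (hne a) (Finset.prod_ne_zero_iff.mpr (fun j _ => hne j))),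
        Multiset.countP_add, Finset.card_insert_of_notMem ha]
      have h1 := (roots_countP_pos_le_signVariations _).trans (signVariations_sparse_le K d hd (c a) (hc a))
      nlinarith [h1, ih]
  have := key Finset.univ
  rwa [Finset.card_univ, Fintype.card_fin] at this

/-- **THE SHARP SECTOR, SIGN-AWARE**: `Z₊(κ X^N + ∏_j f_j) ≤ K·m + 2` for `m` Descartes-sharp `(K+1)`-nomials on a common support,
every `N`, `κ`, `K ≥ 1`, every support. [this file's theorem] -/
theorem sharpK_sector_pos_roots_signed {m : ℕ} (K : ℕ) (hK : 1 ≤ K) (d : ℕ → ℕ) (hd : StrictMono d) (c : Fin m → ℕ → ℝ)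
    (hc : ∀ j i, i < K + 1 → c j i ≠ 0)
    (hsharp : ∀ j, K ≤ (((∑ i ∈ Finset.range (K + 1), C (c j i) * X ^ (d i) : ℝ[X])).roots.toFinset.filter
      (fun t => 0 < t)).card) (N : ℕ) (κ : ℝ) :
    ((C κ * X ^ N + ∏ j, (∑ i ∈ Finset.range (K + 1), C (c j i) * X ^ (d i) : ℝ[X])).roots.toFinset.filter
      (fun t => 0 < t)).card ≤ K * m + 2 := by
  classical
  set P : ℝ[X] := ∏ j, (∑ i ∈ Finset.range (K + 1), C (c j i) * X ^ (d i) : ℝ[X]) with hPdef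
  rcases Nat.eq_zero_or_pos m with hm | hm
  · subst hm
    have hP1 : P = 1 := by rw [hPdef]; exact Fintype.prod_empty _
    rw [hP1]
    have h2 := countP_pos_roots_le_two_of_coeff_nonneg_off (C κ * X ^ N + 1 : ℝ[X]) N (fun i hi => by
      rw [coeff_add, coeff_C_mul_X_pow, if_neg hi, zero_add, coeff_one]
      split_ifs <;> norm_num)
    exact ((StubVLawTwo.card_filter_pos_le_countP _).trans h2).trans (by omega)
  obtain ⟨hP0, hZcard⟩ := prod_sparse_pos_roots_le K d hd c hc
  have hmult : P.roots.countP (fun t => 0 < t) ≤ K * m := countP_pos_roots_prod_sparse_le K d hd c hc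
  by_cases hκ : κ = 0
  · subst hκ
    rw [map_zero, zero_mul, zero_add]
    exact hZcard.trans (by omega)
  set S := (C κ * X ^ N + P).roots.toFinset.filter (fun t => 0 < t) with hSdef
  have hSmem : ∀ z ∈ S, 0 < z ∧ eval z (C κ * X ^ N + P) = 0 := by
    intro z hz
    rw [hSdef, mem_filter, Multiset.mem_toFinset] at hz
    by_cases h0 : C κ * X ^ N + P = 0
    · rw [h0, roots_zero] at hz
      exact absurd hz.1 (Multiset.notMem_zero _)
    · exact ⟨hz.2, (IsRoot.def).mp ((mem_roots h0).mp hz.1)⟩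
  have hPS : ∀ z ∈ S, eval z P = -κ * z ^ N := by
    intro z hz
    have h := (hSmem z hz).2
    rw [eval_add, eval_mul, eval_C, eval_pow, eval_X] at h
    linarith
  have hPne : ∀ z ∈ S, eval z P ≠ 0 := by
    intro z hz
    rw [hPS z hz]
    exact mul_ne_zero (neg_ne_zero.mpr hκ) (pow_ne_zero _ (hSmem z hz).1.ne')
  have hsame : ∀ z ∈ S, ∀ z' ∈ S, 0 < eval z P * eval z' P := by
    intro z hz z' hz'
    rw [hPS z hz, hPS z' hz']
    have : -κ * z ^ N * (-κ * z' ^ N) = κ ^ 2 * (z * z') ^ N := by ring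
    rw [this]
    exact mul_pos (by positivity) (pow_pos (mul_pos (hSmem z hz).1 (hSmem z' hz').1) _)
  have hfacne : ∀ z, eval z P ≠ 0 → ∀ j, (∑ i ∈ Finset.range (K + 1), C (c j i) * X ^ (d i) : ℝ[X]).eval z ≠ 0 := by
    intro z hz j hj
    apply hz
    rw [hPdef, eval_prod, Finset.prod_eq_zero_iff]
    exact ⟨j, mem_univ _, hj⟩
  have hΦ : ∀ w : ℝ, 0 < w → eval w P ≠ 0 →
      eval w (X * derivative (C κ * X ^ N + P) - C (N : ℝ) * (C κ * X ^ N + P)) = 0 →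
      (∑ j, w * (derivative (∑ i ∈ Finset.range (K + 1), C (c j i) * X ^ (d i) : ℝ[X])).eval w
          / (∑ i ∈ Finset.range (K + 1), C (c j i) * X ^ (d i) : ℝ[X]).eval w) = N := by
    intro w hw hPw hd0
    have hE : X * derivative (C κ * X ^ N + P) - C (N : ℝ) * (C κ * X ^ N + P)
        = X * derivative P - C (N : ℝ) * P := by
      have h := euler_sub_monomial P (-κ) N
      rw [map_neg] at h
      rw [show C κ * X ^ N + P = P - -C κ * X ^ N by ring]
      exact h
    rw [hE, eval_sub, eval_mul, eval_X, eval_mul, eval_C, hPdef,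
      eval_euler_prod_general _ (hfacne w hPw), ← eval_prod] at hd0
    rw [hPdef] at hPw
    have : eval w (∏ j, (∑ i ∈ Finset.range (K + 1), C (c j i) * X ^ (d i) : ℝ[X])) *
        ((∑ j, w * (derivative (∑ i ∈ Finset.range (K + 1), C (c j i) * X ^ (d i) : ℝ[X])).eval w
          / (∑ i ∈ Finset.range (K + 1), C (c j i) * X ^ (d i) : ℝ[X]).eval w) - N) = 0 := by
      rw [mul_sub]; linarith
    rcases mul_eq_zero.mp this with h1 | h1
    · exact absurd h1 hPw
    · linarith
  have hΦanti : ∀ w₁ w₂ : ℝ, 0 < w₁ → w₁ < w₂ → (∀ t ∈ Set.Icc w₁ w₂, eval t P ≠ 0) →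
      (∑ j, w₂ * (derivative (∑ i ∈ Finset.range (K + 1), C (c j i) * X ^ (d i) : ℝ[X])).eval w₂
          / (∑ i ∈ Finset.range (K + 1), C (c j i) * X ^ (d i) : ℝ[X]).eval w₂)
        < ∑ j, w₁ * (derivative (∑ i ∈ Finset.range (K + 1), C (c j i) * X ^ (d i) : ℝ[X])).eval w₁
          / (∑ i ∈ Finset.range (K + 1), C (c j i) * X ^ (d i) : ℝ[X]).eval w₁ := by
    intro w₁ w₂ hw₁ hw hfr
    have hne : (Finset.univ : Finset (Fin m)).Nonempty := ⟨⟨0, hm⟩, mem_univ _⟩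
    exact Finset.sum_lt_sum_of_nonempty hne (fun j _ =>
      sharp_phi_strictAnti K hK d hd (c j) (hc j) (hsharp j) hw₁ hw (fun t ht => hfacne t (hfr t ht) j))
  -- three zeros of h in one zero-free interval of P are impossible
  have hthree : ∀ z₁ ∈ S, ∀ z₂ ∈ S, ∀ z₃ ∈ S, z₁ < z₂ → z₂ < z₃ → (∀ t ∈ Set.Icc z₁ z₃, eval t P ≠ 0) → False := by
    intro z₁ hz₁ z₂ hz₂ z₃ hz₃ h12 h23 free13
    have hz₁pos : 0 < z₁ := (hSmem z₁ hz₁).1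
    obtain ⟨w₁, hw₁, hd₁⟩ := exists_root_euler_between (C κ * X ^ N + P) N hz₁pos h12 (hSmem z₁ hz₁).2 (hSmem z₂ hz₂).2
    obtain ⟨w₂, hw₂, hd₂⟩ := exists_root_euler_between (C κ * X ^ N + P) N (hz₁pos.trans h12) h23
      (hSmem z₂ hz₂).2 (hSmem z₃ hz₃).2
    have hw₁pos : 0 < w₁ := hz₁pos.trans hw₁.1
    have hw₁₂ : w₁ < w₂ := hw₁.2.trans hw₂.1
    have hIcc : Set.Icc w₁ w₂ ⊆ Set.Icc z₁ z₃ :=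
      fun t ht => ⟨hw₁.1.le.trans ht.1, ht.2.trans hw₂.2.le⟩
    have hΦ₁ := hΦ w₁ hw₁pos (free13 w₁ (hIcc ⟨le_rfl, hw₁₂.le⟩)) hd₁
    have hΦ₂ := hΦ w₂ (hw₁pos.trans hw₁₂) (free13 w₂ (hIcc ⟨hw₁₂.le, le_rfl⟩)) hd₂
    have hlt := hΦanti w₁ w₂ hw₁pos hw₁₂ (fun t ht => free13 t (hIcc ht))
    rw [hΦ₁, hΦ₂] at hlt
    exact lt_irrefl _ hlt
  -- gap weights: at least 2 whenever the gap contains a zero of P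
  have hgap : ∀ a ∈ S, ∀ b ∈ S, a < b → (∃ t ∈ Set.Ioo a b, eval t P = 0) →
      2 ≤ P.roots.countP (fun t => a < t ∧ t < b) :=
    fun a ha b hb hab hroot => two_le_countP_Ioo_of_same_sign P hab (hsame a ha b hb) hroot
  -- two consecutive gaps carry weight ≥ 2 together
  have hpair : ∀ a ∈ S, ∀ b ∈ S, ∀ e ∈ S, a < b → b < e →
      2 ≤ P.roots.countP (fun t => a < t ∧ t < b) + P.roots.countP (fun t => b < t ∧ t < e) := by
    intro a ha b hb e he hab hbe
    by_cases h1 : ∃ t ∈ Set.Ioo a b, eval t P = 0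
    · have := hgap a ha b hb hab h1; omega
    by_cases h2 : ∃ t ∈ Set.Ioo b e, eval t P = 0
    · have := hgap b hb e he hbe h2; omega
    exfalso
    push Not at h1 h2
    refine hthree a ha b hb e he hab hbe (fun t ht hPt => ?_)
    rcases eq_or_lt_of_le ht.1 with h | h
    · exact hPne a ha (h ▸ hPt)
    rcases lt_trichotomy t b with hb' | hb' | hb'
    · exact h1 t ⟨h, hb'⟩ hPt
    · exact hPne b hb (hb' ▸ hPt)
    rcases eq_or_lt_of_le ht.2 with h' | h'
    · exact hPne e he (h' ▸ hPt)
    · exact h2 t ⟨hb', h'⟩ hPt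
  -- additivity of the counting function along increasing points of S
  have hadd : ∀ a ∈ S, ∀ b ∈ S, a < b →
      P.roots.countP (fun t => 0 < t ∧ t < b) = P.roots.countP (fun t => 0 < t ∧ t < a) + P.roots.countP (fun t => a < t ∧ t < b) := by
    intro a ha b hb hab
    have ha0 := (hSmem a ha).1
    rw [Multiset.countP_eq_countP_filter_add P.roots (fun t => 0 < t ∧ t < b) (fun t => t < a), Multiset.countP_filter,
      Multiset.countP_filter]
    congr 1
    · refine Multiset.countP_congr rfl (fun t _ => ?_)
      simp only [eq_iff_iff]
      constructor
      · rintro ⟨⟨h1, _⟩, h3⟩; exact ⟨h1, h3⟩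
      · rintro ⟨h1, h3⟩; exact ⟨⟨h1, h3.trans hab⟩, h3⟩
    · refine Multiset.countP_congr rfl (fun t ht => ?_)
      have hta : t ≠ a := fun h => hPne a ha (by rw [← h]; exact (mem_roots hP0).mp ht)
      simp only [not_lt, eq_iff_iff]
      constructor
      · rintro ⟨⟨_, h2⟩, h3⟩; exact ⟨lt_of_le_of_ne h3 (Ne.symm hta), h2⟩
      · rintro ⟨h1, h2⟩; exact ⟨⟨ha0.trans h1, h2⟩, h1.le⟩
  -- enumerate S increasingly and run the pairing induction
  set s := S.card with hs
  set e : Fin s ↪o ℝ := S.orderEmbOfFin hs.symm with hedef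
  have hemem : ∀ i, e i ∈ S := fun i => Finset.orderEmbOfFin_mem S hs.symm i
  have helt : ∀ i j : Fin s, i.val < j.val → e i < e j := fun i j h => e.lt_iff_lt.mpr h
  have hind : ∀ n : ℕ, ∀ h : 2 * n < s, 2 * n ≤ P.roots.countP (fun t => 0 < t ∧ t < e ⟨2 * n, h⟩) := by
    intro n
    induction n with
    | zero => intro h; exact Nat.zero_le _
    | succ n ih =>
      intro h
      have h0 : 2 * n < s := by omega
      have h1 : 2 * n + 1 < s := by omega
      have ha := hemem ⟨2 * n, h0⟩
      have hb := hemem ⟨2 * n + 1, h1⟩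
      have hc' := hemem ⟨2 * (n + 1), h⟩
      have hab : e ⟨2 * n, h0⟩ < e ⟨2 * n + 1, h1⟩ := helt _ _ (by simp)
      have hbc : e ⟨2 * n + 1, h1⟩ < e ⟨2 * (n + 1), h⟩ := helt _ _ (by simp; omega)
      have := ih h0
      rw [hadd _ hb _ hc' hbc, hadd _ ha _ hb hab]
      have hp := hpair _ ha _ hb _ hc' hab hbc
      omega
  -- conclude
  by_contra hcon
  push Not at hcon
  -- s ≥ K m + 3; take n with 2n ≤ s - 1
  set n := (s - 1) / 2 with hn
  have h2n : 2 * n < s := by omega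
  have hle := hind n h2n
  have hbound : P.roots.countP (fun t => 0 < t ∧ t < e ⟨2 * n, h2n⟩) ≤ K * m := by
    refine le_trans ?_ hmult
    rw [Multiset.countP_eq_card_filter, Multiset.countP_eq_card_filter]
    exact Multiset.card_le_card (Multiset.monotone_filter_right _ (fun t ht => ht.1))
  omega

/-- **THE SHARP SECTOR OF THE CLASS, SIGN-AWARE, EVERY FORMAT `(m, K)`, EVERY SUPPORT, EVERY COUPLING** (line shape): `K ≥ 2`,
`d` strictly increasing, all `a j l ≠ 0`, every factor with `K − 1` distinct positive zeros ⇒ `Z₊ ≤ (K − 1)m + 2` — val-v1x-eng-10's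
constant. [this file's theorem] -/
theorem sharpK_sector_class_signed {m K : ℕ} (hK : 2 ≤ K) (d : Fin K → ℕ) (hd : StrictMono d) (l₀ : Fin K)
    (a : Fin m → Fin K → ℝ) (ha : ∀ j l, a j l ≠ 0)
    (hsharp : ∀ j, K - 1 ≤ (((∑ l, C (a j l) * X ^ (d l) : ℝ[X])).roots.toFinset.filter (fun t => 0 < t)).card) (c : ℝ) :
    ((C c * X ^ (m * d l₀) + ∏ j, ∑ l, C (a j l) * X ^ (d l) : ℝ[X]).roots.toFinset.filter (fun t => 0 < t)).card
      ≤ (K - 1) * m + 2 := by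
  classical
  obtain ⟨K', rfl⟩ : ∃ K', K = K' + 1 := ⟨K - 1, by omega⟩
  have hK' : 1 ≤ K' := by omega
  set dx : ℕ → ℕ := fun i => if h : i < K' + 1 then d ⟨i, h⟩ else d ⟨K', by omega⟩ + (i - K') with hdx
  set cx : Fin m → ℕ → ℝ := fun j i => if h : i < K' + 1 then a j ⟨i, h⟩ else 0 with hcx
  have hdx_in : ∀ i (h : i < K' + 1), dx i = d ⟨i, h⟩ := fun i h => by simp only [hdx]; exact dif_pos h
  have hdmono : StrictMono dx := by
    intro i j hij
    by_cases hj : j < K' + 1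
    · have hi : i < K' + 1 := by omega
      rw [hdx_in i hi, hdx_in j hj]
      exact hd (Fin.mk_lt_mk.mpr hij)
    · have ej : dx j = d ⟨K', by omega⟩ + (j - K') := by simp only [hdx]; exact dif_neg hj
      rw [ej]
      by_cases hi : i < K' + 1
      · rw [hdx_in i hi]
        have : d ⟨i, hi⟩ ≤ d ⟨K', by omega⟩ := hd.monotone (Fin.mk_le_mk.mpr (by omega))
        omega
      · have ei : dx i = d ⟨K', by omega⟩ + (i - K') := by simp only [hdx]; exact dif_neg hi
        rw [ei]
        omega
  have hcx_ne : ∀ j i, i < K' + 1 → cx j i ≠ 0 := by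
    intro j i hi
    simp only [hcx, dif_pos hi]
    exact ha j _
  have hfac : ∀ j, (∑ l, C (a j l) * X ^ (d l) : ℝ[X]) = ∑ i ∈ Finset.range (K' + 1), C (cx j i) * X ^ (dx i) := by
    intro j
    rw [← Fin.sum_univ_eq_sum_range (fun i => C (cx j i) * X ^ (dx i)) (K' + 1)]
    refine Finset.sum_congr rfl (fun l _ => ?_)
    have hl : (l : ℕ) < K' + 1 := l.isLt
    simp only [hcx, hdx, dif_pos hl, Fin.eta]
  have hsharp' : ∀ j, K' ≤ (((∑ i ∈ Finset.range (K' + 1), C (cx j i) * X ^ (dx i) : ℝ[X])).roots.toFinset.filter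
      (fun t => 0 < t)).card := by
    intro j
    rw [← hfac j]
    have := hsharp j
    simpa using this
  rw [Finset.prod_congr rfl (fun j _ => hfac j)]
  have h := sharpK_sector_pos_roots_signed K' hK' dx hdmono cx hcx_ne hsharp' (m * d l₀) c
  have e : (K' + 1 - 1) = K' := by omega
  rw [e]
  exact h

end ProductPlusOne

end Summit.ValiantsHypothesis.ValiantsHypothesis.Theorems.LacunarySymmetroidMatrixDescartes
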